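import Summits.NavierStokesRegularity.NavierStokesRegularity.Theorems.ProductionEfficiencyDecay.Negative.ProductionEfficiencyDecayFalseOfLerayRateBlowup
import Summits.NavierStokesRegularity.NavierStokesRegularity.Theorems.EfficiencyFloorEnstrophyBudget
import Literature.Analysis.FluidPDE.TaoClassQuotientBalance
import HarnessLib

/-!
# The residual `EfficiencyFloor.EnstrophyQuarterLaw` (stmt-NavierStokesRegularity-1574) HOLDS on the
# exactly discretely self-similar stratum — the stratum where the attacked crux
# `ProductionEfficiencyDecay` (stmt-NavierStokesRegularity-22866) is open

`--supports stmt-NavierStokesRegularity-22866` (line `efficiency_floor`; seat ns-ef-p3). Companion to the lead's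
negative lemmas `ProductionEfficiencyDecay_false_of_DssLerayHopfBlowup` (p585341/p586369: the crux and its BC5 rung
`stub_dssStratumRung` are FALSE modulo one exactly-DSS maximal Leray–Hopf blow-up) and
`ProductionEfficiencyDecay_false_of_LerayRateBlowup` (p586638: the crux is false modulo one Leray-rate blow-up).

THE THEOREM (`quarterLaw_of_dss`, `quarterLaw_on_dssStratum`). For every maximal smooth solution of unforced
Navier–Stokes on `ℝ³ × [0,T)`, Leray–Hopf from its rapidly decaying datum — verbatim the objects both jaws of the
route quantify over — which is discretely self-similar about `(T, 0)` with a factor `c > 1`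
(`IsDiscretelySelfSimilar c (fun s x => u (T + s) x)`, verbatim the extra hypothesis of the skeleton's BC5 rung
`stub_dssStratumRung`), the conclusion of the route's RESIDUAL `EnstrophyQuarterLaw` holds:
`∫⁻|curl u(t)|² ≤ ofReal (K/√(T−t))` on `[0,T)` for some `K`.

PROOF. (1) On the closed sub-slab `[0, T − T/c²]` the enstrophy is bounded, `Z ≤ M`: the solution is a
Chae/BKM-class local solution (`EnstrophyBudget.isLocalSolution`, Tao 2013 Cor. 11.1 through the tree's
`RungReynoldsOne.stub_taoCover`), so all `L²` Sobolev seminorms of `u(t)` — hence of `curl u(t)`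
(`hasBoundedSobolevNormsOn_curl`) — are bounded there. (2) Parabolic DSS scaling multiplies the enstrophy by the
factor: `Z(T − τ/c²) = c·Z(T − τ)` (the lead's `lintegral_curl_sq_dss_iterate`). Every `τ = T − t ∈ (0, T]` is
`τ₀ c^{−2n}` for a `τ₀` in the fundamental period `[T/c², T]` and an `n : ℕ` (least `n` with `T c^{−2(n+1)} ≤ τ`),
so `Z(t) = cⁿ Z(T − τ₀) ≤ cⁿ M ≤ M √T / √(T − t)` because `c^{2n} τ ≤ T`. Hence `K = M √T`.

CONSEQUENCES. `lerayRateBlowup_of_dssLerayHopfBlowup`: the two non-constructible hypotheses of the lead's negative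
lemmas are NESTED, `DssLerayHopfBlowup → LerayRateBlowup` (an exactly-DSS blow-up is an enstrophy-Type-I = Leray-rate
blow-up). So ON THE DSS STRATUM THE PINCER IS DECIDED: the residual jaw (1574) is a theorem there (this file), the
attacked jaw (22866) fails there modulo existence (lead) — the route restricted to that stratum is exactly the
DSS-Liouville statement `¬ DssLerayHopfBlowup` (`dssStratumRung_of_not_lerayRateBlowup`: the BC5 rung already
follows from the weaker exclusion of Leray-rate blow-up).

HONEST FRAMING: a bookkeeping theorem about HYPOTHETICAL blow-up solutions (nobody can construct one); it proves the
residual only on a stratum that regularity would make empty; nothing about NS regularity is asserted, the crux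
stmt-22866 and the residual stmt-1574 stay open. [folklore; DSS scaling as in Bradshaw–Tsai 2017 §1, Chae–Wolf 2017 (1.2)]
-/

-- the problem directory repeats the summit name (`NavierStokesRegularity/NavierStokesRegularity`)
set_option linter.dupNamespace false

noncomputable section

open Set Filter MeasureTheory Topology
open scoped ENNReal NNReal ContDiff
open Literature.Analysis.FluidPDE

namespace Summit.NavierStokesRegularity.NavierStokesRegularity.Theorems

namespace EnstrophyQuarterLawDssStratum

open ProductionEfficiencyDecayNegative (DssLerayHopfBlowup LerayRateBlowup lintegral_curl_sq_dss_iterate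
  dssStratumRung_iff_not_DssLerayHopfBlowup)

variable {ν T : ℝ} {u : ℝ → EuclideanSpace ℝ (Fin 3) → EuclideanSpace ℝ (Fin 3)}
  {p : ℝ → EuclideanSpace ℝ (Fin 3) → ℝ}

/-- **Enstrophy is bounded on every closed sub-slab** `[0, T'']`, `T'' < T`, of a maximal smooth Leray–Hopf
rapidly-decaying-datum solution: it is a Chae/BKM-class local solution (all `L²` Sobolev seminorms of `u(t)`, hence
of `curl u(t)`, bounded on `[0,T'']`). [cite: Tao2011, Cor. 11.1] -/
theorem exists_lintegral_curl_sq_le_on_Icc (hν : 0 < ν) (hT : 0 < T) (hmax : IsMaximalSmoothSolution ν 0 u p T)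
    (hLH : IsLerayHopfOn T ν 0 (u 0) u) (hdec : HasRapidSpatialDecay (u 0)) {T'' : ℝ} (hT'' : T'' < T) :
    ∃ M : ℝ≥0, ∀ t ∈ Icc 0 T'', ∫⁻ x, ‖curl (u t) x‖ₑ ^ 2 ≤ M := by
  have hLS := EnstrophyBudget.isLocalSolution hν hT hmax.isClassicalNSSolutionOn hLH hdec
  have hH : HasBoundedSobolevNormsOn (Icc 0 T'') u := hLS.sobolev T'' hT''
  have hsm : ∀ t ∈ Icc 0 T'', ContDiff ℝ ∞ (u t) := fun t ht =>
    hmax.isClassicalNSSolutionOn.contDiff_velocity ⟨ht.1, ht.2.trans_lt hT''⟩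
  obtain ⟨C, hC⟩ := hasBoundedSobolevNormsOn_curl hH hsm 0
  refine ⟨C, fun t ht => ?_⟩
  calc ∫⁻ x, ‖curl (u t) x‖ₑ ^ 2 = ∫⁻ x, ‖iteratedFDeriv ℝ 0 (curl (u t)) x‖ₑ ^ 2 := by
        refine lintegral_congr fun x => ?_
        rw [← ofReal_norm, ← ofReal_norm, norm_iteratedFDeriv_zero]
    _ ≤ C := hC t ht

/-- **The quarter law on the DSS stratum.** A maximal smooth Leray–Hopf rapidly-decaying-datum solution on
`[0,T)` which is discretely self-similar about `(T,0)` with factor `c > 1` has enstrophy at most Leray's rate: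
`∫⁻|curl u(t)|² ≤ ofReal (K/√(T−t))` on `[0,T)`, with `K = M√T`, `M` the enstrophy bound on the fundamental period
`[0, T − T/c²]`. DSS scaling `Z(T − τ/c²) = c·Z(T − τ)` transports the bound to every later period at exactly the
rate `(T−t)^{−1/2}`. [folklore] -/
theorem quarterLaw_of_dss (hν : 0 < ν) (hT : 0 < T) (hmax : IsMaximalSmoothSolution ν 0 u p T)
    (hLH : IsLerayHopfOn T ν 0 (u 0) u) (hdec : HasRapidSpatialDecay (u 0)) {c : ℝ} (hc : 1 < c)
    (hdss : IsDiscretelySelfSimilar c (fun s x => u (T + s) x)) :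
    ∃ K : ℝ, ∀ t ∈ Ico 0 T, ∫⁻ x, ‖curl (u t) x‖ₑ ^ 2 ≤ ENNReal.ofReal (K / Real.sqrt (T - t)) := by
  have hc0 : 0 < c := one_pos.trans hc
  -- the contraction ratio of one DSS period
  set q : ℝ := (c ^ 2)⁻¹ with hq
  have hc2 : 1 < c ^ 2 := by nlinarith
  have hq0 : 0 < q := by rw [hq]; positivity
  have hq1 : q < 1 := by rw [hq]; exact inv_lt_one_of_one_lt₀ hc2
  have hqc : q * c ^ 2 = 1 := by rw [hq]; exact inv_mul_cancel₀ (by positivity)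
  -- (1) the enstrophy bound on the fundamental period `[0, T - T q]`
  have hTq : T - T * q < T := by nlinarith
  obtain ⟨M, hM⟩ := exists_lintegral_curl_sq_le_on_Icc hν hT hmax hLH hdec hTq
  refine ⟨(M : ℝ) * Real.sqrt T, fun t ht => ?_⟩
  set τ : ℝ := T - t with hτ
  have hτ0 : 0 < τ := by rw [hτ]; linarith [ht.2]
  have hτT : τ ≤ T := by rw [hτ]; linarith [ht.1]
  -- (2) the shell index: the least `n` with `T q^(n+1) ≤ τ`
  have hex : ∃ n : ℕ, T * q ^ (n + 1) ≤ τ := by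
    have hlim : Tendsto (fun n : ℕ => T * q ^ (n + 1)) atTop (𝓝 (T * 0)) :=
      ((tendsto_pow_atTop_nhds_zero_of_lt_one hq0.le hq1).comp (tendsto_add_atTop_nat 1)).const_mul T
    rw [mul_zero] at hlim
    obtain ⟨n, hn⟩ := (hlim.eventually (gt_mem_nhds hτ0)).exists
    exact ⟨n, hn.le⟩
  classical
  obtain ⟨n, hn, hmin⟩ : ∃ n : ℕ, T * q ^ (n + 1) ≤ τ ∧ ∀ m < n, ¬ T * q ^ (m + 1) ≤ τ :=
    ⟨Nat.find hex, Nat.find_spec hex, fun m hm => Nat.find_min hex hm⟩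
  -- the representative `τ₀ = τ c^{2n}` in the fundamental period `[T q, T]`
  set τ₀ : ℝ := τ * (c ^ 2) ^ n with hτ₀
  have hqn : q ^ n * (c ^ 2) ^ n = 1 := by rw [← mul_pow, hqc, one_pow]
  have hτ₀low : T * q ≤ τ₀ := by
    have h := mul_le_mul_of_nonneg_right hn (pow_nonneg (sq_nonneg c) n)
    calc T * q = T * q * (q ^ n * (c ^ 2) ^ n) := by rw [hqn, mul_one]
      _ = T * q ^ (n + 1) * (c ^ 2) ^ n := by ring
      _ ≤ τ * (c ^ 2) ^ n := h
  have hτ₀T : τ₀ ≤ T := by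
    cases n with
    | zero => simpa [hτ₀] using hτT
    | succ m =>
        have hlt : τ < T * q ^ (m + 1) := not_le.1 (hmin m (Nat.lt_succ_self m))
        have h := (mul_lt_mul_of_pos_right hlt (pow_pos (pow_pos hc0 2) (m + 1))).le
        calc τ * (c ^ 2) ^ (m + 1) ≤ T * q ^ (m + 1) * (c ^ 2) ^ (m + 1) := h
          _ = T * (q ^ (m + 1) * (c ^ 2) ^ (m + 1)) := by ring
          _ = T := by rw [← mul_pow, hqc, one_pow, mul_one]
  -- the enstrophy at the representative time is at most `M`
  have hper : T - τ₀ ∈ Icc 0 (T - T * q) := ⟨by linarith, by linarith⟩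
  have hZ₀ : ∫⁻ x, ‖curl (u (T - τ₀)) x‖ₑ ^ 2 ≤ M := hM (T - τ₀) hper
  -- DSS scaling from the representative time to `t`
  have hiter := lintegral_curl_sq_dss_iterate hc0 hdss τ₀ n
  have h1 : T + -τ₀ * (c ^ 2)⁻¹ ^ n = t := by
    rw [hτ₀, ← hq, show T + -(τ * (c ^ 2) ^ n) * q ^ n = T - τ * (q ^ n * (c ^ 2) ^ n) by ring, hqn,
      mul_one, hτ]
    ring
  have h2 : T + -τ₀ = T - τ₀ := by ring
  rw [h1, h2] at hiter
  -- `cⁿ ≤ √T / √τ` since `c^{2n} τ = τ₀ ≤ T`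
  have hsqτ : 0 < Real.sqrt τ := Real.sqrt_pos.2 hτ0
  have hcn : c ^ n ≤ Real.sqrt T / Real.sqrt τ := by
    rw [le_div_iff₀ hsqτ]
    have hlhs : 0 ≤ c ^ n * Real.sqrt τ := by positivity
    rw [← Real.sqrt_sq hlhs]
    refine Real.sqrt_le_sqrt ?_
    calc (c ^ n * Real.sqrt τ) ^ 2 = (c ^ 2) ^ n * τ := by
          rw [mul_pow, Real.sq_sqrt hτ0.le]; ring
      _ = τ₀ := by rw [hτ₀, mul_comm]
      _ ≤ T := hτ₀T
  calc ∫⁻ x, ‖curl (u t) x‖ₑ ^ 2 = ENNReal.ofReal c ^ n * ∫⁻ x, ‖curl (u (T - τ₀)) x‖ₑ ^ 2 := hiter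
    _ ≤ ENNReal.ofReal c ^ n * (M : ℝ≥0∞) := mul_le_mul' le_rfl hZ₀
    _ = ENNReal.ofReal (c ^ n * M) := by
        rw [ENNReal.ofReal_mul (pow_nonneg hc0.le n), ENNReal.ofReal_pow hc0.le, ENNReal.ofReal_coe_nnreal]
    _ ≤ ENNReal.ofReal ((M : ℝ) * Real.sqrt T / Real.sqrt (T - t)) := by
        refine ENNReal.ofReal_le_ofReal ?_
        rw [← hτ, mul_div_assoc, mul_comm]
        exact mul_le_mul_of_nonneg_left hcn M.coe_nonneg

/-- **`EnstrophyQuarterLaw` restricted to the DSS stratum is a theorem** (same binder prefix as the skeleton's BC5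
rung `stub_dssStratumRung` of stmt-22866, conclusion of the route's residual `EnstrophyQuarterLaw`, stmt-1574):
every exactly-DSS maximal smooth Leray–Hopf rapidly-decaying-datum solution has enstrophy at most Leray's rate.
[folklore] -/
theorem quarterLaw_on_dssStratum : ∀ (ν T : ℝ), 0 < ν → 0 < T →
    ∀ (u : ℝ → EuclideanSpace ℝ (Fin 3) → EuclideanSpace ℝ (Fin 3)) (p : ℝ → EuclideanSpace ℝ (Fin 3) → ℝ),
    Literature.Analysis.FluidPDE.IsMaximalSmoothSolution ν 0 u p T →
    Literature.Analysis.FluidPDE.IsLerayHopfOn T ν 0 (u 0) u →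
    Literature.Analysis.FluidPDE.HasRapidSpatialDecay (u 0) →
    (∃ c : ℝ, 1 < c ∧ Literature.Analysis.FluidPDE.IsDiscretelySelfSimilar c (fun s x => u (T + s) x)) →
    ∃ K : ℝ, ∀ t ∈ Set.Ico 0 T,
      ∫⁻ x, ‖Literature.Analysis.FluidPDE.curl (u t) x‖ₑ ^ 2 ≤ ENNReal.ofReal (K / Real.sqrt (T - t)) := by
  intro ν T hν hT u p hmax hLH hdec hdss
  obtain ⟨c, hc, hdss⟩ := hdss
  exact quarterLaw_of_dss hν hT hmax hLH hdec hc hdss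

/-- **The two non-constructible hypotheses of the line's negative lemmas are nested**: an exactly-DSS maximal
Leray–Hopf blow-up (`DssLerayHopfBlowup`, p585341) is a Leray-rate blow-up (`LerayRateBlowup`, p586638).
[folklore] -/
theorem lerayRateBlowup_of_dssLerayHopfBlowup (hH : DssLerayHopfBlowup) : LerayRateBlowup := by
  obtain ⟨ν, T, u, p, hν, hT, hmax, hLH, hdec, c, hc, hdss⟩ := hH
  exact ⟨ν, T, u, p, hν, hT, hmax, hLH, hdec, quarterLaw_of_dss hν hT hmax hLH hdec hc hdss⟩

/-- **The BC5 rung follows from the exclusion of Leray-rate blow-up**: `¬ LerayRateBlowup` (no maximal Leray–Hopf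
rapidly-decaying-datum solution with enstrophy `≤ K/√(T−t)`) implies the skeleton's `stub_dssStratumRung`
(signature verbatim), through `dssStratumRung_iff_not_DssLerayHopfBlowup` (p586369) and the nesting above. So on the
DSS stratum the pincer of route `EfficiencyFloor` is decided: the residual holds (`quarterLaw_on_dssStratum`), the
crux fails modulo existence (`ProductionEfficiencyDecay_false_of_DssLerayHopfBlowup`), and what is left is exactly
DSS-blow-up exclusion. [folklore] -/
theorem dssStratumRung_of_not_lerayRateBlowup (hno : ¬ LerayRateBlowup) :
    ∀ (ν T : ℝ), 0 < ν → 0 < T → ∀ (u : ℝ → EuclideanSpace ℝ (Fin 3) → EuclideanSpace ℝ (Fin 3)) (p : ℝ → EuclideanSpace ℝ (Fin 3) → ℝ), Literature.Analysis.FluidPDE.IsMaximalSmoothSolution ν 0 u p T → Literature.Analysis.FluidPDE.IsLerayHopfOn T ν 0 (u 0) u → Literature.Analysis.FluidPDE.HasRapidSpatialDecay (u 0) → (∃ c : ℝ, 1 < c ∧ Literature.Analysis.FluidPDE.IsDiscretelySelfSimilar c (fun s x => u (T + s) x)) → ∀ ε : ℝ, 0 < ε → ∃ t₁ ∈ Set.Ico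 0 T, (∀ t ∈ Set.Ico t₁ T, 0 < ∫⁻ x, ‖Literature.Analysis.FluidPDE.curl (u t) x‖ₑ ^ 2 ∧ ∫⁻ x, ‖Literature.Analysis.FluidPDE.curl (u t) x‖ₑ ^ 2 < ⊤) ∧ ∀ s t : ℝ, t₁ ≤ s → s ≤ t → t < T → ((∫⁻ x, ‖Literature.Analysis.FluidPDE.curl (u s) x‖ₑ ^ 2).toReal)⁻¹ ^ 2 - ((∫⁻ x, ‖Literature.Analysis.FluidPDE.curl (u t) x‖ₑ ^ 2).toReal)⁻¹ ^ 2 ≤ ε * (t - s) :=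
  dssStratumRung_iff_not_DssLerayHopfBlowup.2 fun hH => hno (lerayRateBlowup_of_dssLerayHopfBlowup hH)

end EnstrophyQuarterLawDssStratum

end Summit.NavierStokesRegularity.NavierStokesRegularity.Theorems

end
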